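import Summits.Ventures.Crystal3D.Bulk.GapVertexStar
import Summits.Ventures.Crystal3D.Bulk.GapExtremal
import HarnessLib

/-!
# Darts of the two-level tight graph and the face-successor map (first brick of the face
# theory, `phase2/LEAN-FACES-DESIGN.md` (F1))

HONEST FRAMING. Part of the venture `Summits/Ventures/Crystal3D` (cell `pub-crystal3d`, phase 2;
seat typer-bulk-2). The census enumerates PLANE MAPS; the kernel has the fan (P-L3(a)) and the
cyclic order of the tight partners at every vertex (`Bulk/GapVertexStar.lean`), but no notion of
FACE yet. This file sets up the combinatorial map in Tutte/Hales style, on which faces are the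
orbits of the face-successor permutation:

* `darts c` — the ordered tight pairs `(i, j)`, `i, j ≠ 0`, `dist (c i) (c j) = 1`;
  `card_darts` (`= 2 · tightCount c`, the handshake with `Bulk/GapExtremal.tightCount`);
* `nextNbr c i j` — the tight partner of `i` following `j` in the counter-clockwise order around
  `gapDir c i` (the vertex rotation `σ`; identity off the partners), `nextNbr_mem`;
* `faceSucc c (i, j) = (j, nextNbr c j i)` — arrive at `j` along the arc `i → j`, leave along the
  next arc after `j → i` counter-clockwise (`φ = σ ∘ α`); `faceSucc_mem_darts`, and
  **`IsGapConfig.faceSucc_injOn`**: for an admissible configuration with `intruderDist² < 3` it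
  is injective on `darts c`, hence a PERMUTATION of the finite set of darts
  (`IsGapConfig.faceSucc_bijOn`); its orbits are the combinatorial faces (not developed here).

Nothing is claimed about GAP(1.26); Euler's formula / planarity of this map (F2) is NOT here.
-/

noncomputable section

open scoped BigOperators InnerProductSpace
open Finset Real

namespace Summit.Ventures.Crystal3D

open Literature.Geometry.DiscreteGeometry

variable {c : Fin 14 → EuclideanSpace ℝ (Fin 3)}

/-! ## Darts -/

/-- The **darts** of the tight graph: ordered pairs `(i, j)` of distinct balls other than ball `0`
at distance exactly `1`. -/
def darts (c : Fin 14 → EuclideanSpace ℝ (Fin 3)) : Finset (Fin 14 × Fin 14) :=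
  univ.filter fun q => q.1 ≠ 0 ∧ q.2 ≠ 0 ∧ q.1 ≠ q.2 ∧ dist (c q.1) (c q.2) = 1

/-- Membership in `darts`. -/
theorem mem_darts {q : Fin 14 × Fin 14} :
    q ∈ darts c ↔ q.1 ≠ 0 ∧ q.2 ≠ 0 ∧ q.1 ≠ q.2 ∧ dist (c q.1) (c q.2) = 1 := by
  simp [darts]

/-- A dart reversed is a dart (the edge involution `α`). -/
theorem swap_mem_darts {q : Fin 14 × Fin 14} (hq : q ∈ darts c) : q.swap ∈ darts c := by
  obtain ⟨h1, h2, h3, h4⟩ := mem_darts.1 hq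
  exact mem_darts.2 ⟨h2, h1, h3.symm, by rw [dist_comm]; exact h4⟩

/-- The second entry of a dart is a tight partner of the first. -/
theorem snd_mem_tightNbrs_of_mem_darts {q : Fin 14 × Fin 14} (hq : q ∈ darts c) :
    q.2 ∈ tightNbrs c q.1 := by
  obtain ⟨_, h2, h3, h4⟩ := mem_darts.1 hq
  exact mem_tightNbrs.2 ⟨h2, h3.symm, h4⟩

/-- Conversely a tight partner gives a dart. -/
theorem mk_mem_darts {i j : Fin 14} (hi0 : i ≠ 0) (hj : j ∈ tightNbrs c i) : (i, j) ∈ darts c := by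
  obtain ⟨hj0, hji, hd⟩ := mem_tightNbrs.1 hj
  exact mem_darts.2 ⟨hi0, hj0, hji.symm, hd⟩

/-- **Handshake**: the number of darts is twice the number of tight pairs (`tightCount` of
`Bulk/GapExtremal.lean` counts the pairs `i < j`). -/
theorem card_darts (c : Fin 14 → EuclideanSpace ℝ (Fin 3)) : (darts c).card = 2 * tightCount c := by
  classical
  -- split the darts into `i < j` and `j < i`
  set up := (darts c).filter fun q => q.1 < q.2 with hup
  set dn := (darts c).filter fun q => q.2 < q.1 with hdn
  have hsplit : darts c = up ∪ dn := by
    ext q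
    simp only [hup, hdn, Finset.mem_union, Finset.mem_filter]
    constructor
    · intro hq
      rcases lt_or_gt_of_ne (mem_darts.1 hq).2.2.1 with h | h
      · exact Or.inl ⟨hq, h⟩
      · exact Or.inr ⟨hq, h⟩
    · rintro (⟨hq, _⟩ | ⟨hq, _⟩) <;> exact hq
  have hdisj : Disjoint up dn := by
    rw [Finset.disjoint_filter]
    intro q _ h1 h2
    exact lt_asymm h1 h2
  -- `up` is the set counted by `tightCount`
  have hupc : up.card = tightCount c := by
    unfold tightCount
    congr 1
    ext q
    simp only [hup, Finset.mem_filter, mem_darts, Finset.mem_product, Finset.mem_univ, true_and]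
    constructor
    · rintro ⟨⟨h1, -, -, h4⟩, hlt⟩
      exact ⟨h1, hlt, h4⟩
    · rintro ⟨h1, hlt, h4⟩
      refine ⟨⟨h1, ?_, ne_of_lt hlt, h4⟩, hlt⟩
      intro h0
      rw [h0] at hlt
      exact absurd hlt (not_lt.2 (Fin.zero_le _))
  -- `dn` is the image of `up` under swapping
  have hdnc : dn.card = up.card := by
    have himg : dn = up.image Prod.swap := by
      ext q
      simp only [hdn, hup, Finset.mem_filter, Finset.mem_image]
      constructor
      · rintro ⟨hq, hlt⟩
        exact ⟨q.swap, ⟨swap_mem_darts hq, hlt⟩, Prod.swap_swap q⟩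
      · rintro ⟨r, ⟨hr, hlt⟩, rfl⟩
        exact ⟨swap_mem_darts hr, hlt⟩
    rw [himg, Finset.card_image_of_injective _ Prod.swap_injective]
  rw [hsplit, Finset.card_union_of_disjoint hdisj, hdnc, hupc]
  ring

/-! ## The vertex rotation and the face successor -/

/-- **The next tight partner of `i` after `j`** in the counter-clockwise order around
`gapDir c i` (the vertex rotation `σ_i`); `j` itself if `j` is not (the azimuth-indexed image of)
a tight partner. -/
def nextNbr (c : Fin 14 → EuclideanSpace ℝ (Fin 3)) (i j : Fin 14) : Fin 14 :=
  if h : ∃ m : Fin (tightAngles c i).card, tightNbrAt c i rfl m = j then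
    tightNbrAt c i rfl (finRotate _ (Classical.choose h))
  else j

/-- Unfolding `nextNbr` at a partner in position `m`. -/
theorem nextNbr_eq_of_tightNbrAt {i : Fin 14} (m : Fin (tightAngles c i).card) :
    nextNbr c i (tightNbrAt c i rfl m) =
      tightNbrAt c i rfl (finRotate (tightAngles c i).card m) := by
  have h : ∃ m' : Fin (tightAngles c i).card, tightNbrAt c i rfl m' = tightNbrAt c i rfl m :=
    ⟨m, rfl⟩
  unfold nextNbr
  rw [dif_pos h]
  have hm : Classical.choose h = m := tightNbrAt_injective c i rfl (Classical.choose_spec h)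
  rw [hm]

/-- The next partner is a tight partner. -/
theorem nextNbr_mem {i j : Fin 14} (hj : j ∈ tightNbrs c i)
    (hsurj : ∃ m : Fin (tightAngles c i).card, tightNbrAt c i rfl m = j) :
    nextNbr c i j ∈ tightNbrs c i := by
  obtain ⟨m, rfl⟩ := hsurj
  have _ := hj
  rw [nextNbr_eq_of_tightNbrAt]
  exact tightNbrAt_mem c i rfl _

/-- For an admissible configuration with `intruderDist² < 3`, every tight partner has a position
(the azimuths are distinct), so `nextNbr` permutes the tight partners of each vertex. -/
theorem IsGapConfig.exists_pos (hc : IsGapConfig c) (hD3 : intruderDist c ^ 2 < 3) {i j : Fin 14}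
    (hi0 : i ≠ 0) (hj : j ∈ tightNbrs c i) :
    ∃ m : Fin (tightAngles c i).card, tightNbrAt c i rfl m = j :=
  hc.exists_tightNbrAt_eq hD3 hi0 rfl hj

/-- `nextNbr c i` is injective on the tight partners of `i` (admissible, `D² < 3`). -/
theorem IsGapConfig.nextNbr_injOn (hc : IsGapConfig c) (hD3 : intruderDist c ^ 2 < 3) {i : Fin 14}
    (hi0 : i ≠ 0) : Set.InjOn (nextNbr c i) (tightNbrs c i : Set (Fin 14)) := by
  intro j hj j' hj' h
  rw [Finset.mem_coe] at hj hj'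
  obtain ⟨m, rfl⟩ := hc.exists_pos hD3 hi0 hj
  obtain ⟨m', rfl⟩ := hc.exists_pos hD3 hi0 hj'
  rw [nextNbr_eq_of_tightNbrAt, nextNbr_eq_of_tightNbrAt] at h
  have := tightNbrAt_injective c i rfl h
  rw [(finRotate _).injective this]

/-- **The face successor** `φ(i, j) = (j, σ_j(i))`: arrive at `j` along `i → j` and leave along
the tight arc at `j` that follows `j → i` counter-clockwise. Its orbits on `darts c` are the
combinatorial faces of the tight map. -/
def faceSucc (c : Fin 14 → EuclideanSpace ℝ (Fin 3)) (q : Fin 14 × Fin 14) : Fin 14 × Fin 14 :=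
  (q.2, nextNbr c q.2 q.1)

/-- The face successor of a dart is a dart (admissible, `D² < 3`). -/
theorem IsGapConfig.faceSucc_mem_darts (hc : IsGapConfig c) (hD3 : intruderDist c ^ 2 < 3)
    {q : Fin 14 × Fin 14} (hq : q ∈ darts c) : faceSucc c q ∈ darts c := by
  have hq' := swap_mem_darts hq
  have h2 : (q.swap).1 ≠ 0 := (mem_darts.1 hq').1
  have hmem := snd_mem_tightNbrs_of_mem_darts hq'
  simp only [Prod.fst_swap, Prod.snd_swap] at h2 hmem
  exact mk_mem_darts h2 (nextNbr_mem hmem (hc.exists_pos hD3 h2 hmem))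

/-- **The face successor is injective on darts** (admissible, `D² < 3`): `φ(i,j) = φ(i',j')` forces
`j = j'` and then `σ_j(i) = σ_j(i')`, `i = i'`. -/
theorem IsGapConfig.faceSucc_injOn (hc : IsGapConfig c) (hD3 : intruderDist c ^ 2 < 3) :
    Set.InjOn (faceSucc c) (darts c : Set (Fin 14 × Fin 14)) := by
  intro q hq q' hq' h
  rw [Finset.mem_coe] at hq hq'
  simp only [faceSucc, Prod.mk.injEq] at h
  obtain ⟨h2, hn⟩ := h
  have hi := snd_mem_tightNbrs_of_mem_darts (swap_mem_darts hq)
  have hi' := snd_mem_tightNbrs_of_mem_darts (swap_mem_darts hq')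
  simp only [Prod.fst_swap, Prod.snd_swap] at hi hi'
  have hj0 : q.2 ≠ 0 := (mem_darts.1 hq).2.1
  rw [← h2] at hi' hn
  have h1 : q.1 = q'.1 := hc.nextNbr_injOn hD3 hj0 hi hi' hn
  exact Prod.ext h1 h2

/-- Hence the face successor is a **bijection of the finite set of darts** onto itself
(admissible, `D² < 3`) — a permutation whose cycles are the faces. -/
theorem IsGapConfig.faceSucc_bijOn (hc : IsGapConfig c) (hD3 : intruderDist c ^ 2 < 3) :
    Set.BijOn (faceSucc c) (darts c : Set (Fin 14 × Fin 14)) (darts c : Set (Fin 14 × Fin 14)) := by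
  have hmaps : Set.MapsTo (faceSucc c) (darts c : Set (Fin 14 × Fin 14)) (darts c) :=
    fun q hq => Finset.mem_coe.2 (hc.faceSucc_mem_darts hD3 (Finset.mem_coe.1 hq))
  have hinj := hc.faceSucc_injOn hD3
  -- surjective: an injective self-map of a finite set
  exact ⟨hmaps, hinj, Finset.surjOn_of_injOn_of_card_le _ hmaps hinj le_rfl⟩

end Summit.Ventures.Crystal3D
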